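import Summits.NavierStokesRegularity.NavierStokesRegularity.Theses.PalasekTowerBreakdown
import Summits.NavierStokesRegularity.FluidComputer.PalasekTowerGermHostAmplifier

/-!
# `EpisodeBase` BY NAME for «the tiny strict carrier + ANY amplifier far away»: host preparation for
# every design a mechanism card can name

Cell `ns-blowup`, seat `ns-blowup-ecbridge-3` (g4); GROUP C «BRIDGE SUPPORT» of the route
`PalasekTowerBreakdown`, crux `EpisodeBase` (item stmt-NavierStokesRegularity-19179, R2 of record; line
`slot`: ONE stub `∃ U ρ c₄ (h : Germ.LevelZeroData U ρ) …, PushedLevelWitness (h.schedule c₄ …)`). Companion of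
`PalasekTowerBreakdownEpisodeBaseGerm.lean` (g3; not imported, to stay off its route cone) over `FluidComputer/PalasekTowerGermHostAmplifier.lean`
(GermHost XXII). LABEL: E–C typing (KERNEL, proofs only, by name). WHAT THIS IS NOT: not Navier–Stokes
evidence — the prescribed level-`0` host of a PRESCRIBED composite profile and conditionals whose
hypothesis is the OPEN episode of that design; nothing about any flow after `τ₀`, `RungG 1` or blow-up.
HELPER for 19179 (`--supports`), closes nothing.

For EVERY amplifier `W` (smooth, divergence free, `tsupport W ⊆ B̄(0, R)`, `R ≥ 0`, speed `< Y₀`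
everywhere) and every centre `c` with `‖c‖ ≥ 8 + R + max(1/N₀, 1 + 3Y₀∫‖W‖²/(2π·rate⋆))`:

* `palasekTowerBreakdown_exists_preparedHost_amplifier`: a pinned (`Λ = 8`, `θ = 6/5`), rigid, quiet
  schedule of radius `‖c‖ + R` with `τ₀ = 1` — the germ schedule of `strictTinyProfile a⋆ + W(· − c)` —
  PREPARED in its singleton class, and such that its episode gives the crux (∃-packaged, no dependent
  slot proof in the statement);
* `palasekTowerBreakdown_episodeBase_of_amplifier_levelWitness`: `EpisodeBase ⇐` ONE level witness of
  that germ schedule (a classical finite-energy flow of its forced system from rest reaching `τ₁` below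
  `(5/3)Y₁` on the window with the three level-`1` floors at `τ₁` in `B̄(0, ‖c‖ + R)`);
* `palasekTowerBreakdown_episodeBase_of_amplifier_firstEpisodeD`: `EpisodeBase ⇐ FirstEpisodeD` of it.

References: S. Palasek, arXiv:2605.13827 §3.3, §4 (Step 2) [cite: Palasek2026ElementaryModel, §4];
H. Sohr, *The Navier–Stokes Equations* (2001), Ch. V Thm. 1.5.1 [cite: Sohr2001, Ch. V Thm. 1.5.1].
-/

noncomputable section

-- `Summit.<Summit>.<Problem>` is the tree's mandated summit-side namespace (CONVENTIONS §2); for this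
-- single-conjunct summit the two coincide, so the duplicate is deliberate.
set_option linter.dupNamespace false

namespace Summit.NavierStokesRegularity.NavierStokesRegularity.Theorems

open Set Function Metric MeasureTheory Real
open scoped ContDiff
open Summit.NavierStokesRegularity.FluidComputer.PalasekTowerClayBridge
open Summit.NavierStokesRegularity.FluidComputer.PalasekTowerClayBridge.Germ
open Literature.Analysis.FluidPDE

variable {W : EuclideanSpace ℝ (Fin 3) → EuclideanSpace ℝ (Fin 3)} {R : ℝ} {c : EuclideanSpace ℝ (Fin 3)}
  (hW : ContDiff ℝ ∞ W) (hdivW : VectorCalculus.IsDivFree W) (hWsupp : tsupport W ⊆ closedBall 0 R)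
  (hWlt : ∀ x, ‖W x‖ < TowerRates.wide.Y 0) (hR : 0 ≤ R)
  (hc : 8 + R + max (1 / TowerRates.wide.N 0)
      (1 + 3 * TowerRates.wide.Y 0 * (∫ x, ‖W x‖ ^ 2) / (2 * π * levelZeroData_named.rate)) ≤ ‖c‖)

include hW hdivW hWsupp hWlt hR hc

/-- **A PREPARED HOST FOR EVERY AMPLIFIER** (∃-packaged): for every push `c₄ ∈ (0, 1]` there is a pinned,
rigid, quiet schedule on the wide rates, of radius `‖c‖ + R` and readout time `τ₀ = 1`, PREPARED in its
singleton class, whose episode gives the crux — the germ schedule of `strictTinyProfile a⋆ + W(· − c)`.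
[cite: Palasek2026ElementaryModel, §4] -/
theorem palasekTowerBreakdown_exists_preparedHost_amplifier {c₄ : ℝ} (hc₄ : 0 < c₄) (hc₄' : c₄ ≤ 1) :
    ∃ S : Schedule TowerRates.wide, S.Pins 8 (6 / 5) ∧ S.Rigid ∧ S.Quiet ∧ S.radius = ‖c‖ + R ∧
      S.τ 0 = 1 ∧ HostPreparationD (HostClass.exact S) ∧
        (FirstEpisodeD (HostClass.exact S) →
          Summit.NavierStokesRegularity.NavierStokesRegularity.Theses.PalasekTowerBreakdown.EpisodeBase) := by
  have h := levelZeroData_strictTiny_add_translate hW hdivW hWsupp hWlt hR hc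
  exact ⟨h.schedule c₄ hc₄ hc₄', h.schedule_pins hc₄ hc₄', h.schedule_rigid hc₄ hc₄',
    h.schedule_quiet hc₄ hc₄', h.schedule_radius hc₄ hc₄', h.schedule_τ_zero hc₄ hc₄',
    h.hostPreparationD_exact hc₄ hc₄',
    fun hF => h.episodeBaseG_of_firstEpisodeD hc₄ hc₄' hF⟩

/-- **`EpisodeBase` from ONE LEVEL WITNESS of «tiny strict carrier + amplifier far away»** (no re-push).
[cite: Sohr2001, Ch. V Thm. 1.5.1] -/
theorem palasekTowerBreakdown_episodeBase_of_amplifier_levelWitness {c₄ : ℝ} (hc₄ : 0 < c₄)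
    (hc₄' : c₄ ≤ 1)
    (hLW : ((levelZeroData_strictTiny_add_translate hW hdivW hWsupp hWlt hR hc).schedule
      c₄ hc₄ hc₄').LevelWitness 1 0) :
    Summit.NavierStokesRegularity.NavierStokesRegularity.Theses.PalasekTowerBreakdown.EpisodeBase := by
  have h := levelZeroData_strictTiny_add_translate hW hdivW hWsupp hWlt hR hc
  exact h.episodeBaseG_of_firstEpisodeD hc₄ hc₄'
    (firstEpisodeD_exact_of_levelWitness_self (h.schedule_pins hc₄ hc₄') (h.schedule_rigid hc₄ hc₄')
      (h.schedule_quiet hc₄ hc₄') hLW)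

/-- **`EpisodeBase` from the EPISODE of «tiny strict carrier + amplifier far away».**
[cite: Palasek2026ElementaryModel, §4] -/
theorem palasekTowerBreakdown_episodeBase_of_amplifier_firstEpisodeD {c₄ : ℝ} (hc₄ : 0 < c₄)
    (hc₄' : c₄ ≤ 1)
    (hF : FirstEpisodeD (HostClass.exact
      ((levelZeroData_strictTiny_add_translate hW hdivW hWsupp hWlt hR hc).schedule c₄ hc₄ hc₄'))) :
    Summit.NavierStokesRegularity.NavierStokesRegularity.Theses.PalasekTowerBreakdown.EpisodeBase :=
  (levelZeroData_strictTiny_add_translate hW hdivW hWsupp hWlt hR hc).episodeBaseG_of_firstEpisodeD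
    hc₄ hc₄' hF

end Summit.NavierStokesRegularity.NavierStokesRegularity.Theorems

end
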